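import Summits.BirchSwinnertonDyer.BirchSwinnertonDyer.Theorems.ManinLocalTwoThreeManinPrimeToAdditiveFiveLeOptimalPartner
import Summits.BirchSwinnertonDyer.BirchSwinnertonDyer.Theorems.ManinLocalTwoThreeManinPrimeToAdditiveFiveLeUpperAnchorOfFacts
import Summits.BirchSwinnertonDyer.BirchSwinnertonDyer.Theorems.ManinLocalTwoThreeManinPrimeToAdditiveFiveLeReducibleResidueThirteenStub
import Summits.BirchSwinnertonDyer.Rank1Residual.ManinAdditive.TwistOrbitManinNearInvariance
import HarnessLib

/-!
# Route `ManinLocalTwoThree`, residual crux C5 `ManinPrimeToAdditiveFiveLe`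
# (stmt-BirchSwinnertonDyer-22969), line `upper_anchor`: **the `W[13]`-reducible residue RED(13♯)
# reduces to a MANIN-FREE degree law** — along `W ⊗ 13` from an UNSTARRED optimal curve the optimal
# modular degree goes UP by the factor `13`

Lead seat bsd-line-ml23-c5-p1 (gen 3). Skeleton v4 of the line (`Cruxes/ManinPrimeToAdditiveFiveLe/
Lines/upper_anchor.lean`, sha16 4cca099bd9a9ccdc) registers as `stub_red13sharp` the residue RED(13♯) =
hypothesis `h13s` of `coreRED13_of_cremona_of_coreRED13sharp` (p614544): for `W/ℚ` globally minimal with a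
lattice-optimal conductor-level datum `D`, `13² ∣ N(W) > 5·10⁵`, `W[13]` reducible, `ord₁₃ Δ_min(W) ≤ 4`
(Kodaira II/III/IV), globally twist-minimal, (G)-ordinary, `13 ∣ deg φ`: `13 ∤ c(D)`. In print this is
Edixhoven's open «case 1» on the Eisenstein locus (1991, Thm. 3 and §4: only `v₁₃(c) ≤ 1`).

THIS FILE proves, kernel-checked, that RED(13♯) follows from Edixhoven's printed Kodaira-type statement
(cite-only fact `edixhoven_not_dvd_maninConstant_of_kodairaSymbol_ne`, already an input of the line) and ONE
statement about MODULAR DEGREES in which no Manin constant occurs: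

* **`DegreeUp13Red`** (hypothesis `hUp`, the new registered stub of skeleton v5): for `W, D` as in RED(13♯)
  and ANY globally minimal `W′` with a lattice-optimal conductor-level datum `D′`, `N(W′) = N(W)` and
  `W ⊗ 13 ∼ W′` (here `13* = 13`): `deg(D′) = 13 · deg(D)`.

Proof of `coreRED13sharp_of_edixhovenKodairaFact_of_degreeUp13Red` (§2). The lattice-optimal curve `W′`
of the class of `W ⊗ 13` exists (modularity + Edixhoven's Prop. 2, tree `exists_isIsogenous_latticeOptimal`);
twist-minimality of `W` at `13` gives `13² ∣ N(W′)`, hence `N(W′) = N(W)`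
(`conductorNorm_eq_of_isIsogenous_twist_pStar_of_sq_dvd`). The cell's PROVED optimal-orbit trichotomy
(`pStar_optimal_orbit_trichotomy_full`, an lens §24; Edixhoven §4 / Zagier 1985 lattice steps
`g·Λ(f ⊗ χ) ⊆ Λ(f)`, `g·Λ(f) ⊆ Λ(f ⊗ χ)`): (i) `W′ ≅ W ⊗ 13` and `deg′ = 13·deg`, or (ii) `W′ ≅ W ⊗ 13` and
`13·deg′ = deg`, or (iii) `deg′ = deg` (the non-commuting «flip»). `DegreeUp13Red` kills (ii) and (iii).
In case (i) the PROVED near-invariance (`pStar_optimal_commuting_manin_near_invariance`, §27) gives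
`v₁₃ c(D′) = v₁₃ c(D)` and `ord₁₃ Δ_min(W′) = ord₁₃ Δ_min(W) + 6 ∈ {8, 9, 10}` (the other branch would need
`ord₁₃ Δ_min(W′) + 6 = ord₁₃ Δ_min(W) ≤ 4`), so `W′` is of Kodaira type IV*, III* or II* at `13`
(`kodairaSymbolAt_upper_starred`, irreducibility-free) and Edixhoven's statement (`13 > 7`) yields
`13 ∤ c(D′)`, whence `13 ∤ c(D)`. The (G)-ordinary clause of RED(13♯) is idle here (passed through).

§1 records the irreducibility-free upper anchor at `p > 7` (the width seat's `upperAnchor_of_edixhovenKodairaFact`,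
p607661, carries an unused `W[p]`-irreducibility binder). §3 records the converse bookkeeping on COMMUTING
orbits: granted Edixhoven's statement, for an unstarred optimal `W` additive at `p > 7` and its commuting
optimal partner, `p ∤ c(D) ↔ deg(D′) = p·deg(D)` — so on the commuting locus the degree law IS Manin's
statement (Edixhoven's case 2), and the only extra content of `DegreeUp13Red` is the exclusion of flips.

WHY THE FLIP EXCLUSION IS THE RIGHT RESIDUAL (paper analysis, not formalised; for the planner). By
Dokchitser–Dokchitser, *Local invariants of isogenous elliptic curves*, Trans. AMS 367 (2015) 4339–4358
(= arXiv:1208.5519), Table 1 and §5 (a `p`-isogeny at `ℓ = p` between curves with additive potentially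
ORDINARY reduction preserves `ord_p Δ_min` and the Kodaira type; `13 ≡ 1 (mod 12)` makes every additive
potentially good curve at `13` potentially ordinary), the rational `13`-isogeny `π : W → W₂` keeps
II/III/IV, so EVERY curve of the class of `W ⊗ 13` is starred and Edixhoven's statement applies to `W′`
in the flip case too; the covolume bookkeeping then reads `v₁₃ c(D) = 1 − v₁₃(π^*ω_{W₂}/ω_W)`, i.e. in a
flip Manin's `13 ∤ c(D)` holds iff `ker π` is the canonical subgroup at `13` iff `W` (= the `X₀`- and the
`X₁`-optimal curve of its class, the Shimura cover having order prime to `13` by Mazur's torsion theorem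
and Mazur–Kenku) is NOT the curve of minimal Faltings height — contradicting Stevens' conjecture. So a
flip on this locus refutes Manin ∧ Stevens; the cell census (N ≤ 5·10⁵) has 12 such orbits, all commuting.

HONEST STATUS. Conditional result (`--supports`, helper): the inputs are a cite-only printed fact and an
open degree law. Nothing here proves C5, Manin's conjecture, or BSD.

References: [EdixhovenManin1991] Thm. 3, §4 (cases 1/2, pp. 12–13 of the typescript); [Zagier1985CMB] §1;
[DokchitserDokchitser2015] Table 1, §5; [Stevens1989] §2; [Mazur1978] Thm. 1; [Kenku1982].
-/

set_option autoImplicit false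
-- the Theorems namespace of this sub repeats the summit name by design (D-0017 nested layout)
set_option linter.dupNamespace false

noncomputable section

open scoped Classical NumberField

namespace Summit.BirchSwinnertonDyer.BirchSwinnertonDyer.Theorems

open WeierstrassCurve IsDedekindDomain NumberField Rat.HeightOneSpectrum
  Literature.NumberTheory.EllipticCurves Literature.NumberTheory.EllipticCurves.ModularForms
  Literature.NumberTheory.EllipticCurves.Rank1Residual
  Summit.BirchSwinnertonDyer.Rank1Residual.ManinAdditive
  Summit.BirchSwinnertonDyer.Rank1Residual.Additive

/-! ## §1 The irreducibility-free upper anchor at `p > 7` -/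

/-- **Upper anchor at `p > 7`, no irreducibility** (Edixhoven 1991 Thm. 3, Kodaira half, cite-only fact
`hEd`): on a commuting `χ_{p*}`-pair `u • (W ⊗ χ_{p*}) = W'` of globally minimal curves at a common conductor
`N`, `p² ∣ N`, `7 < p`, with `W'` the UPPER member (`ord_p Δ_min(W') = ord_p Δ_min(W) + 6`), every
lattice-optimal conductor-level datum `D'` of `W'` has `p ∤ c(D')`: both members are additive at `p`, the
upper one is of type IV*/III*/II* (`kodairaSymbolAt_upper_starred`), and the fact applies. Same proof as the
width seat's `upperAnchor_of_edixhovenKodairaFact` (p607661) minus its idle `W[p]`-irreducibility binder.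
Conditional result. [cite: EdixhovenManin1991, Thm. 3] [cite: SilvermanATAEC1994, IV Table 4.1] -/
theorem upperAnchor_of_edixhovenKodairaFact_red
    (hEd : edixhoven_not_dvd_maninConstant_of_kodairaSymbol_ne)
    {p : ℕ} (hp : p.Prime) (h7 : 7 < p)
    (W W' : WeierstrassCurve ℚ) [W.IsElliptic] [W.IsGloballyMinimal] [W'.IsElliptic]
    [W'.IsGloballyMinimal] [NeZero (W.conductorNorm ℤ)] [NeZero (W'.conductorNorm ℤ)]
    (u : VariableChange ℚ) (D' : ModularParametrizationData W' (W'.conductorNorm ℤ))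
    (hD' : IsLatticeOptimal D') (hpN : p ^ 2 ∣ W.conductorNorm ℤ)
    (hNN : W'.conductorNorm ℤ = W.conductorNorm ℤ)
    (hu : u • W.quadraticTwist ((((-1 : ℤ) ^ (p / 2) * p : ℤ)) : ℚ) = W')
    (hΔ : padicValInt p W'.minimalDiscriminantInt = padicValInt p W.minimalDiscriminantInt + 6) :
    ¬ (p : ℤ) ∣ D'.maninConstant := by
  haveI : Fact p.Prime := ⟨hp⟩
  have h5 : 5 ≤ p := by omega
  have hW : Addv W p := not_good_and_not_mult_of_sq_dvd_conductorNorm W hpN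
  have hW' : Addv W' p :=
    not_good_and_not_mult_of_sq_dvd_conductorNorm W' (by rw [hNN]; exact hpN)
  have hst := kodairaSymbolAt_upper_starred h5 u hu hW hW' hΔ
  have hII : W'.kodairaSymbolAt (placeOf p) ≠ .II := by
    rcases hst with ⟨h, -⟩ | ⟨h, -⟩ | ⟨h, -⟩ <;> rw [h] <;> decide
  have hIII : W'.kodairaSymbolAt (placeOf p) ≠ .III := by
    rcases hst with ⟨h, -⟩ | ⟨h, -⟩ | ⟨h, -⟩ <;> rw [h] <;> decide
  have hIV : W'.kodairaSymbolAt (placeOf p) ≠ .IV := by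
    rcases hst with ⟨h, -⟩ | ⟨h, -⟩ | ⟨h, -⟩ <;> rw [h] <;> decide
  exact hEd W' D' hD' p hp h7 hII hIII hIV

/-! ## §2 RED(13♯) ⟸ Edixhoven's Kodaira statement ∧ the degree law `DegreeUp13Red` -/

/-- **Core RED(13♯) of skeleton v4 (registered `stub_red13sharp` = hypothesis `h13s` of
`coreRED13_of_cremona_of_coreRED13sharp`, VERBATIM as the conclusion) follows from Edixhoven 1991 Thm. 3
(Kodaira half, cite-only fact `hEd`) and the MANIN-FREE degree law `DegreeUp13Red` (`hUp`):** for `W`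
globally minimal with a lattice-optimal conductor-level datum `D`, `13² ∣ N(W)`, `W[13]` reducible,
`ord₁₃ Δ_min(W) ≤ 4`, globally twist-minimal, (G)-ordinary, `13 ∣ deg(D)`, `N(W) > 5·10⁵`, and every
globally minimal `W′` with a lattice-optimal conductor-level datum `D′`, `N(W′) = N(W)`, `W ⊗ 13 ∼ W′`:
`deg(D′) = 13·deg(D)` ⟹ `13 ∤ c(D)`. See the module docstring for the proof (optimal-orbit trichotomy,
near-invariance, upper anchor). Conditional result; nothing here proves C5.
[cite: EdixhovenManin1991, Thm. 3 and §4] [cite: ZagierCMB1985, §1] -/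
theorem coreRED13sharp_of_edixhovenKodairaFact_of_degreeUp13Red
    (hEd : edixhoven_not_dvd_maninConstant_of_kodairaSymbol_ne)
    (hUp : exists_isNewformOf →
      ∀ (W : WeierstrassCurve ℚ) [W.IsElliptic] [W.IsGloballyMinimal] [NeZero (W.conductorNorm ℤ)]
        (D : ModularParametrizationData W (W.conductorNorm ℤ)),
        IsLatticeOptimal D → ∀ p : ℕ, p.Prime → p = 13 → p ^ 2 ∣ W.conductorNorm ℤ →
        ¬ (∃ (W' : WeierstrassCurve ℚ) (q : ℕ), W'.IsElliptic ∧ W'.IsGloballyMinimal ∧ q.Prime ∧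
            q ≠ 2 ∧ q ^ 2 ∣ W.conductorNorm ℤ ∧
            IsIsogenous W (W'.quadraticTwist (((-1 : ℤ) ^ (q / 2) * q : ℤ) : ℚ)) ∧
            ¬ q ^ 2 ∣ W'.conductorNorm ℤ) →
        ¬ (∃ (W' : WeierstrassCurve ℚ) (d : ℤ), W'.IsElliptic ∧ W'.IsGloballyMinimal ∧
            (d = -1 ∨ d = 2 ∨ d = -2) ∧ 2 ^ 2 ∣ W.conductorNorm ℤ ∧
            IsIsogenous W (W'.quadraticTwist (d : ℚ)) ∧ ¬ 2 ^ 2 ∣ W'.conductorNorm ℤ) →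
        ¬ W.HasIrreducibleModPGaloisRep p →
        padicValInt p W.minimalDiscriminantInt ≤ 4 →
        (∃ (L : Type) (_ : Field L) (_ : NumberField L) (_ : IsCyclotomicExtension {p} ℚ L)
            (F : IntermediateField ℚ L),
            ∀ w : HeightOneSpectrum (𝓞 F), (p : 𝓞 F) ∈ w.asIdeal →
              (W.baseChange F).HasGoodReductionAt w ∧ (W.baseChange F).HasUnitRootAt w) →
        p ∣ D.modularDegree →
        500000 < W.conductorNorm ℤ →
        ∀ (W' : WeierstrassCurve ℚ) [W'.IsElliptic] [W'.IsGloballyMinimal] [NeZero (W'.conductorNorm ℤ)]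
          (D' : ModularParametrizationData W' (W'.conductorNorm ℤ)),
          IsLatticeOptimal D' → W'.conductorNorm ℤ = W.conductorNorm ℤ →
          IsIsogenous (W.quadraticTwist (((-1 : ℤ) ^ (p / 2) * p : ℤ) : ℚ)) W' →
          D'.modularDegree = p * D.modularDegree) :
    mazur_not_dvd_maninConstant_of_odd → abbesUllmo_not_dvd_maninConstant_of_not_dvd_level →
    cesnavicius_not_two_dvd_maninConstant_of_two_dvd_level → exists_isNewformOf →
    ∀ (W : WeierstrassCurve ℚ) [W.IsElliptic] [W.IsGloballyMinimal] [NeZero (W.conductorNorm ℤ)]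
      (D : ModularParametrizationData W (W.conductorNorm ℤ)),
      IsLatticeOptimal D → ∀ p : ℕ, p.Prime → p = 13 → p ^ 2 ∣ W.conductorNorm ℤ →
      ¬ (∃ (W' : WeierstrassCurve ℚ) (q : ℕ), W'.IsElliptic ∧ W'.IsGloballyMinimal ∧ q.Prime ∧
          q ≠ 2 ∧ q ^ 2 ∣ W.conductorNorm ℤ ∧
          IsIsogenous W (W'.quadraticTwist (((-1 : ℤ) ^ (q / 2) * q : ℤ) : ℚ)) ∧
          ¬ q ^ 2 ∣ W'.conductorNorm ℤ) →
      ¬ (∃ (W' : WeierstrassCurve ℚ) (d : ℤ), W'.IsElliptic ∧ W'.IsGloballyMinimal ∧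
          (d = -1 ∨ d = 2 ∨ d = -2) ∧ 2 ^ 2 ∣ W.conductorNorm ℤ ∧
          IsIsogenous W (W'.quadraticTwist (d : ℚ)) ∧ ¬ 2 ^ 2 ∣ W'.conductorNorm ℤ) →
      ¬ W.HasIrreducibleModPGaloisRep p →
      padicValInt p W.minimalDiscriminantInt ≤ 4 →
      (∃ (L : Type) (_ : Field L) (_ : NumberField L) (_ : IsCyclotomicExtension {p} ℚ L)
          (F : IntermediateField ℚ L),
          ∀ w : HeightOneSpectrum (𝓞 F), (p : 𝓞 F) ∈ w.asIdeal →
            (W.baseChange F).HasGoodReductionAt w ∧ (W.baseChange F).HasUnitRootAt w) →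
      p ∣ D.modularDegree →
      500000 < W.conductorNorm ℤ →
      ¬ (p : ℤ) ∣ D.maninConstant := by
  intro _hM _hAU _hC hnf W _ _ _ D hD p hp hp13 hpN hodd hdy hred hlow hGo hdeg h500
  subst hp13
  haveI : Fact (Nat.Prime 13) := ⟨hp⟩
  have hd0 : ((((-1 : ℤ) ^ (13 / 2) * 13 : ℤ)) : ℚ) ≠ 0 := by norm_num
  haveI : (W.quadraticTwist (((-1 : ℤ) ^ (13 / 2) * 13 : ℤ) : ℚ)).IsElliptic :=
    W.isElliptic_quadraticTwist hd0
  -- the lattice-optimal globally minimal curve `W₀` of the class of `W ⊗ 13`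
  obtain ⟨W₀, hE₀, hM₀, hne₀, D₀, hD₀, hiso⟩ :=
    exists_isIsogenous_latticeOptimal hnf (W.quadraticTwist (((-1 : ℤ) ^ (13 / 2) * 13 : ℤ) : ℚ))
  haveI := hE₀
  haveI := hM₀
  haveI := hne₀
  haveI : (W₀.quadraticTwist (((-1 : ℤ) ^ (13 / 2) * 13 : ℤ) : ℚ)).IsElliptic :=
    W₀.isElliptic_quadraticTwist hd0
  -- `W ∼ W₀ ⊗ 13`: `W ≅ (W ⊗ 13) ⊗ 13` and `W ⊗ 13 ∼ W₀`
  have htw : IsIsogenous W (W₀.quadraticTwist (((-1 : ℤ) ^ (13 / 2) * 13 : ℤ) : ℚ)) := by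
    obtain ⟨C, hC⟩ := W.exists_variableChange_smul_eq_quadraticTwist_sq hd0
    have h1 : IsIsogenous W ((W.quadraticTwist (((-1 : ℤ) ^ (13 / 2) * 13 : ℤ) : ℚ)).quadraticTwist
        (((-1 : ℤ) ^ (13 / 2) * 13 : ℤ) : ℚ)) := by
      rw [quadraticTwist_quadraticTwist, ← sq, ← hC]
      exact isIsogenous_smul _ _
    exact h1.trans' (hiso.quadraticTwist hd0)
  -- twist-minimality of `W` at `13`: `13² ∣ N(W₀)`; hence `N(W₀) = N(W)`
  have hpN₀ : 13 ^ 2 ∣ W₀.conductorNorm ℤ := by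
    by_contra h
    exact hodd ⟨W₀, 13, hE₀, hM₀, hp, by norm_num, hpN, htw, h⟩
  have hNN : W₀.conductorNorm ℤ = W.conductorNorm ℤ :=
    conductorNorm_eq_of_isIsogenous_twist_pStar_of_sq_dvd hnf (by norm_num) htw hpN hpN₀
  -- the degree law: `deg(D₀) = 13 · deg(D)`
  have hup : D₀.modularDegree = 13 * D.modularDegree :=
    hUp hnf W D hD 13 hp rfl hpN hodd hdy hred hlow hGo hdeg h500 W₀ D₀ hD₀ hNN hiso
  have hpos : 0 < D.modularDegree := D.deg_pos
  -- the optimal-orbit trichotomy: only case (i) is compatible with the degree law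
  rcases pStar_optimal_orbit_trichotomy_full hp (by norm_num) W W₀ D D₀ hD hD₀ hpN hNN hiso with
    ⟨⟨u, hu⟩, -, -⟩ | ⟨-, hdeg₂, -⟩ | hdeg₃
  · -- case (i): commuting; near-invariance along the commuting pair
    rcases pStar_optimal_commuting_manin_near_invariance hp (by norm_num) W W₀ u D D₀ hD hD₀ hpN hNN hu
      with ⟨-, ⟨hc, hΔ⟩ | ⟨-, hΔ⟩⟩ | ⟨hdeg₂, -⟩
    · -- `v₁₃ c₀ = v₁₃ c` and `W₀` is the UPPER member: Edixhoven's statement applies to `(W₀, D₀)`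
      have hnd : ¬ ((13 : ℕ) : ℤ) ∣ D₀.maninConstant :=
        upperAnchor_of_edixhovenKodairaFact_red hEd hp (by norm_num) W W₀ u D₀ hD₀ hpN hNN hu hΔ
      have hv₀ : padicValInt 13 D₀.c = 0 := padicValInt.eq_zero_of_not_dvd hnd
      have hc0 : D.c ≠ 0 := Int.cast_ne_zero.mp D.cast_c_ne_zero
      intro h13
      have h13' : ((13 : ℕ) : ℤ) ^ 1 ∣ D.c := by rw [pow_one]; exact h13
      rcases (padicValInt_dvd_iff 1 D.c).mp h13' with h | h
      · exact hc0 h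
      · omega
    · -- the other branch would need `ord₁₃ Δ_min(W₀) + 6 = ord₁₃ Δ_min(W) ≤ 4`
      omega
    · -- `13 · deg₀ = deg` contradicts `deg₀ = 13 · deg > 0`
      omega
  · -- case (ii): `13 · deg₀ = deg` contradicts the degree law
    omega
  · -- case (iii): `deg₀ = deg` contradicts the degree law
    omega

/-! ## §3 On COMMUTING orbits the degree law is exactly Manin's statement (Edixhoven's case 2) -/

/-- **Granted Edixhoven 1991 Thm. 3 (Kodaira half), on a commuting optimal `χ_{p*}`-pair from an UNSTARRED
curve the degree law IS Manin's statement:** for `p > 7`, `u • (W ⊗ χ_{p*}) = W'` globally minimal at a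
common conductor `N`, `p² ∣ N`, lattice-optimal conductor-level data `D, D'`, and `ord_p Δ_min(W) ≤ 4`:
`p ∤ c(D) ↔ deg(D') = p · deg(D)`. (→) is the PROVED near-invariance alone (the branch `p·deg′ = deg`
forces `v_p c = v_p c′ + 1 ≥ 1` or `ord_p Δ_min(W) = ord_p Δ_min(W′) + 6 ≥ 6`); (←) is §1 on the upper
member `W'`. So the extra content of `DegreeUp13Red` over RED(13♯) is only the exclusion of
non-commuting («flip») orbits. Conditional result. [cite: EdixhovenManin1991, Thm. 3 and §4] -/
theorem not_dvd_maninConstant_iff_degreeUp_of_commuting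
    (hEd : edixhoven_not_dvd_maninConstant_of_kodairaSymbol_ne)
    {p : ℕ} (hp : p.Prime) (h7 : 7 < p)
    (W W' : WeierstrassCurve ℚ) [W.IsElliptic] [W.IsGloballyMinimal] [W'.IsElliptic]
    [W'.IsGloballyMinimal] [NeZero (W.conductorNorm ℤ)] [NeZero (W'.conductorNorm ℤ)]
    (u : VariableChange ℚ) (D : ModularParametrizationData W (W.conductorNorm ℤ))
    (D' : ModularParametrizationData W' (W'.conductorNorm ℤ))
    (hD : IsLatticeOptimal D) (hD' : IsLatticeOptimal D') (hpN : p ^ 2 ∣ W.conductorNorm ℤ)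
    (hNN : W'.conductorNorm ℤ = W.conductorNorm ℤ)
    (hu : u • W.quadraticTwist ((((-1 : ℤ) ^ (p / 2) * p : ℤ)) : ℚ) = W')
    (hlow : padicValInt p W.minimalDiscriminantInt ≤ 4) :
    ¬ (p : ℤ) ∣ D.maninConstant ↔ D'.modularDegree = p * D.modularDegree := by
  haveI : Fact p.Prime := ⟨hp⟩
  have hp2 : p ≠ 2 := by omega
  have hpos : 0 < D.modularDegree := D.deg_pos
  have hc0 : D.c ≠ 0 := Int.cast_ne_zero.mp D.cast_c_ne_zero
  have hnear := pStar_optimal_commuting_manin_near_invariance hp hp2 W W' u D D' hD hD' hpN hNN hu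
  constructor
  · intro hnd
    have hv : padicValInt p D.c = 0 := padicValInt.eq_zero_of_not_dvd hnd
    rcases hnear with ⟨hdeg, -⟩ | ⟨-, ⟨-, hΔ⟩ | ⟨hc, -⟩⟩
    · exact hdeg
    · omega
    · omega
  · intro hdeg
    rcases hnear with ⟨-, ⟨hc, hΔ⟩ | ⟨-, hΔ⟩⟩ | ⟨hdeg₂, -⟩
    · have hnd : ¬ (p : ℤ) ∣ D'.maninConstant :=
        upperAnchor_of_edixhovenKodairaFact_red hEd hp h7 W W' u D' hD' hpN hNN hu hΔ
      have hv' : padicValInt p D'.c = 0 := padicValInt.eq_zero_of_not_dvd hnd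
      intro hdvd
      have hdvd' : (p : ℤ) ^ 1 ∣ D.c := by rw [pow_one]; exact hdvd
      rcases (padicValInt_dvd_iff 1 D.c).mp hdvd' with h | h
      · exact hc0 h
      · omega
    · omega
    · have : p * (p * D.modularDegree) = D.modularDegree := by rw [← hdeg]; exact hdeg₂
      nlinarith [hp.two_le]

end Summit.BirchSwinnertonDyer.BirchSwinnertonDyer.Theorems

end
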